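import Summits.Ventures.LatticeQCDFlow.TrivializingMaps.FlowAutocorrelationFloorAnyGroup

/-!
HONEST FRAMING: exact (Metropolis-corrected) sampling algorithms for lattice gauge theory; figures
of merit are autocorrelation/cost numbers at stated couplings and volumes; no continuum-physics
claim.

# FlowAutocorrelationCeilingAnyGroup — THE OTHER SIDE: A MODEL DENSITY THAT COVERS THE WILSON DENSITY UP TO
# A FACTOR `C` (`p_β ≤ C·q`) GIVES EVERY CENTRED BOUNDED OBSERVABLE `|ρ_g(n)| ≤ (1 − 1/C)ⁿ` AND
# `τ_W, τ_int ≤ C − ½` — EVERY COMPACT GAUGE GROUP, EVERY COUPLING (lean-2 GEN-12, ours)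

Venture-side (OURS).  Cell `lqcd-flow` (pub-lqcd), unit `pub-lqcd-lean-2-g12`, 2026-08-23.  The Wilson docking
of row 2's general-space CEILING for the exact flow sampler (`Exactness/FlowSamplerAutocorrelation`:
`|C(n)| ≤ (1 − Z/C)ⁿ C(0)`, `τ_W, τ_int ≤ C/Z − ½` from a weight bound `w ≤ C q`; there for the scalar `φ⁴` rung),
complementing the FLOOR of `FlowAutocorrelationFloorAnyGroup` / `FlowTauIntWindowFloor`.  With the normalised
Wilson density `p = e^{β(−S_W)}/mgf(β)` over `D[U]` (`Z = ∫ p dD[U] = 1`) the weight bound reads `p ≤ C·q`: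
the flow's model density is at least `1/C` of the target density everywhere (importance weights `≤ C`).

* **`wilson_flow_abs_autocorr_le`** — `|ρ_g(n)| ≤ (1 − 1/C)ⁿ` for every bounded measurable `g` with
  `E_{μ_β}[g] = 0`;
* **`wilson_flow_tauIntWindow_le`** — `τ_W(ρ_g) ≤ C − ½` for every window `W`;
* **`wilson_flow_tauInt_le`** — `τ_int(ρ_g) ≤ C − ½` (row 2's summability under the weight bound).

Reading (no numerics implied): TWO-SIDED — for the exact flow sampler of the Wilson measure of any compact gauge
group at any coupling, `½ + W·(1 − B²·acc/E_β[g²])^W ≤ τ_W(g) ≤ sup(p_β/q) − ½`: fast decorrelation of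
every observable is EQUIVALENT, up to these constants, to a uniformly bounded importance weight, whose
logarithm is at least `D(μ_β ‖ q)` — extensive in the volume for any model a bounded factor away from the Haar
prior (GEN-10's `EntropyFromHaar` / `FlowESSCeilingAnyGroup`).  NOT CLAIMED: the size of `sup(p_β/q)` for any
architecture; unbounded observables; the continuum.  Literature grade: KNOWN MECHANISM (Liu 1996; Smith–Tierney
1996; Mengersen–Tweedie 1996: spectral gap `1/W` of the independence sampler), NEW TYPING; nothing cited as a
fact.
-/

noncomputable section

open MeasureTheory ProbabilityTheory Real Set Filter Finset
open Literature.MathematicalPhysics.QuantumFieldTheory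
open Literature.MathematicalPhysics.QuantumFieldTheory.Luscher2010
open Summit.Ventures.LatticeQCDFlow.Exactness
open Summit.Ventures.LatticeQCDFlow.Scaling
open Summit.Ventures.LatticeQCDFlow.Scoring

namespace Summit.Ventures.LatticeQCDFlow.TrivializingMaps

section Wilson

variable {d L N : ℕ} [NeZero L] {G : Type*} [Group G] [TopologicalSpace G] [IsTopologicalGroup G]
  [CompactSpace G] [MeasurableSpace G] [BorelSpace G] [SecondCountableTopology G]
  (ρ : G →* Matrix (Fin N) (Fin N) ℂ)

/-- The normalised Wilson density integrates to one over `D[U]`. [folklore] -/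
theorem integral_wilsonDensity_eq_one (hρ : Continuous ρ) (β : ℝ) :
    ∫ U, exp (β * (-wilsonAction ρ U)) / mgf (fun U => -wilsonAction ρ U) (trivialMeasure G d L) β
        ∂(trivialMeasure G d L) = 1 := by
  haveI := isProbabilityMeasure_wilsonMeasure (d := d) (L := L) ρ hρ β
  have h := integral_mul_wilsonDensity_eq (d := d) (L := L) ρ hρ β (fun _ => (1 : ℝ))
  simp only [one_mul, integral_const, probReal_univ, smul_eq_mul, mul_one] at h
  exact h

/-- **AUTOCORRELATION CEILING FROM A COVERING MODEL** (every compact `G`, every real `β`): if the model density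
`q > 0` (`∫ q dD[U] = 1`) satisfies `p_β ≤ C·q` for the normalised Wilson density `p_β`, then for every bounded
measurable `g` with `E_{μ_β}[g] = 0` and every `n`: `|E_{μ_β}[g·Kⁿg]| ≤ (1 − 1/C)ⁿ·E_{μ_β}[g²]`. [ours] -/
theorem wilson_flow_abs_autocorr_le (hρ : Continuous ρ) (β : ℝ) {q : GaugeConfig d L G → ℝ}
    (hqm : Measurable q) (hq0 : ∀ U, 0 < q U) (hq1 : ∫ U, q U ∂(trivialMeasure G d L) = 1) {C : ℝ}
    (hC : ∀ U, exp (β * (-wilsonAction ρ U)) / mgf (fun U => -wilsonAction ρ U) (trivialMeasure G d L) β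
      ≤ C * q U)
    {g : GaugeConfig d L G → ℝ} (hgm : Measurable g) {B : ℝ} (hgb : ∀ U, |g U| ≤ B)
    (hg0 : ∫ U, g U ∂(wilsonMeasure (d := d) (L := L) ρ β) = 0) (n : ℕ) :
    |∫ U, g U * ((imhOp (trivialMeasure G d L)
        (fun U => exp (β * (-wilsonAction ρ U)) / mgf (fun U => -wilsonAction ρ U) (trivialMeasure G d L) β)
        q)^[n] g) U ∂(wilsonMeasure (d := d) (L := L) ρ β)| ≤
      (1 - 1 / C) ^ n * ∫ U, g U ^ 2 ∂(wilsonMeasure (d := d) (L := L) ρ β) := by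
  haveI : IsProbabilityMeasure (trivialMeasure G d L) := trivialMeasure_isProbabilityMeasure
  set w : GaugeConfig d L G → ℝ := fun U => exp (β * (-wilsonAction ρ U)) /
    mgf (fun U => -wilsonAction ρ U) (trivialMeasure G d L) β with hw
  have hmgf : 0 < mgf (fun U => -wilsonAction ρ U) (trivialMeasure G d L) β :=
    mgf_pos (integrable_trivialMeasure_of_continuous_group
      (continuous_exp.comp (continuous_const.mul (continuous_wilsonAction_of_continuous ρ hρ).neg)))
  have hw0 : ∀ U, 0 < w U := fun U => div_pos (exp_pos _) hmgf
  have hwc : Continuous w :=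
    (continuous_exp.comp (continuous_const.mul (continuous_wilsonAction_of_continuous ρ hρ).neg)).div_const _
  have hwi : Integrable w (trivialMeasure G d L) := integrable_trivialMeasure_of_continuous_group hwc
  have hqi : Integrable q (trivialMeasure G d L) := by
    by_contra h
    rw [integral_undef h] at hq1
    exact zero_ne_one hq1
  have hZ : ∫ U, w U ∂(trivialMeasure G d L) = 1 := integral_wilsonDensity_eq_one (d := d) (L := L) ρ hρ β
  have hg0' : ∫ U, g U * w U ∂(trivialMeasure G d L) = 0 := by
    rw [integral_mul_wilsonDensity_eq ρ hρ β, hg0]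
  have h := abs_autocov_le hw0 hwc.measurable hwi hq0 hqm hqi hq1 hC hgm hgb hg0' n
  rw [integral_mul_wilsonDensity_eq ρ hρ β, integral_mul_wilsonDensity_eq ρ hρ β, hZ] at h
  exact h

/-- **WINDOWED `τ_int` CEILING FROM A COVERING MODEL**: under the same hypotheses, for every window `W`,
`τ_W(ρ_g) ≤ C − ½`. [ours] -/
theorem wilson_flow_tauIntWindow_le (hρ : Continuous ρ) (β : ℝ) {q : GaugeConfig d L G → ℝ}
    (hqm : Measurable q) (hq0 : ∀ U, 0 < q U) (hq1 : ∫ U, q U ∂(trivialMeasure G d L) = 1) {C : ℝ}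
    (hC : ∀ U, exp (β * (-wilsonAction ρ U)) / mgf (fun U => -wilsonAction ρ U) (trivialMeasure G d L) β
      ≤ C * q U)
    {g : GaugeConfig d L G → ℝ} (hgm : Measurable g) {B : ℝ} (hgb : ∀ U, |g U| ≤ B)
    (hg0 : ∫ U, g U ∂(wilsonMeasure (d := d) (L := L) ρ β) = 0) (W : ℕ) :
    tauIntWindow (fun n => (∫ U, g U * ((imhOp (trivialMeasure G d L)
        (fun U => exp (β * (-wilsonAction ρ U)) / mgf (fun U => -wilsonAction ρ U) (trivialMeasure G d L) β)
        q)^[n] g) U ∂(wilsonMeasure (d := d) (L := L) ρ β)) /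
        ∫ U, g U ^ 2 ∂(wilsonMeasure (d := d) (L := L) ρ β)) W ≤ C - 1 / 2 := by
  haveI : IsProbabilityMeasure (trivialMeasure G d L) := trivialMeasure_isProbabilityMeasure
  set w : GaugeConfig d L G → ℝ := fun U => exp (β * (-wilsonAction ρ U)) /
    mgf (fun U => -wilsonAction ρ U) (trivialMeasure G d L) β with hw
  have hmgf : 0 < mgf (fun U => -wilsonAction ρ U) (trivialMeasure G d L) β :=
    mgf_pos (integrable_trivialMeasure_of_continuous_group
      (continuous_exp.comp (continuous_const.mul (continuous_wilsonAction_of_continuous ρ hρ).neg)))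
  have hw0 : ∀ U, 0 < w U := fun U => div_pos (exp_pos _) hmgf
  have hwc : Continuous w :=
    (continuous_exp.comp (continuous_const.mul (continuous_wilsonAction_of_continuous ρ hρ).neg)).div_const _
  have hwi : Integrable w (trivialMeasure G d L) := integrable_trivialMeasure_of_continuous_group hwc
  have hqi : Integrable q (trivialMeasure G d L) := by
    by_contra h
    rw [integral_undef h] at hq1
    exact zero_ne_one hq1
  have hZ : ∫ U, w U ∂(trivialMeasure G d L) = 1 := integral_wilsonDensity_eq_one (d := d) (L := L) ρ hρ β
  have hg0' : ∫ U, g U * w U ∂(trivialMeasure G d L) = 0 := by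
    rw [integral_mul_wilsonDensity_eq ρ hρ β, hg0]
  have h := tauIntWindow_autocorr_le hw0 hwc.measurable hwi hq0 hqm hqi hq1 hC hgm hgb hg0' W
  have e : (fun n => (∫ U, g U * ((imhOp (trivialMeasure G d L) w q)^[n] g) U * w U ∂(trivialMeasure G d L)) /
      ∫ U, g U ^ 2 * w U ∂(trivialMeasure G d L)) =
      fun n => (∫ U, g U * ((imhOp (trivialMeasure G d L) w q)^[n] g) U ∂(wilsonMeasure (d := d) (L := L) ρ β)) /
        ∫ U, g U ^ 2 ∂(wilsonMeasure (d := d) (L := L) ρ β) := by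
    funext n
    rw [integral_mul_wilsonDensity_eq ρ hρ β, integral_mul_wilsonDensity_eq ρ hρ β]
  rw [e, hZ, div_one] at h
  exact h

/-- **`τ_int` CEILING FROM A COVERING MODEL**: under the same hypotheses `τ_int(ρ_g) ≤ C − ½` (the
autocorrelation series is summable under the weight bound — row 2). [ours] -/
theorem wilson_flow_tauInt_le (hρ : Continuous ρ) (β : ℝ) {q : GaugeConfig d L G → ℝ}
    (hqm : Measurable q) (hq0 : ∀ U, 0 < q U) (hq1 : ∫ U, q U ∂(trivialMeasure G d L) = 1) {C : ℝ}
    (hC : ∀ U, exp (β * (-wilsonAction ρ U)) / mgf (fun U => -wilsonAction ρ U) (trivialMeasure G d L) β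
      ≤ C * q U)
    {g : GaugeConfig d L G → ℝ} (hgm : Measurable g) {B : ℝ} (hgb : ∀ U, |g U| ≤ B)
    (hg0 : ∫ U, g U ∂(wilsonMeasure (d := d) (L := L) ρ β) = 0) :
    tauInt (fun n => (∫ U, g U * ((imhOp (trivialMeasure G d L)
        (fun U => exp (β * (-wilsonAction ρ U)) / mgf (fun U => -wilsonAction ρ U) (trivialMeasure G d L) β)
        q)^[n] g) U ∂(wilsonMeasure (d := d) (L := L) ρ β)) /
        ∫ U, g U ^ 2 ∂(wilsonMeasure (d := d) (L := L) ρ β)) ≤ C - 1 / 2 := by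
  haveI : IsProbabilityMeasure (trivialMeasure G d L) := trivialMeasure_isProbabilityMeasure
  set w : GaugeConfig d L G → ℝ := fun U => exp (β * (-wilsonAction ρ U)) /
    mgf (fun U => -wilsonAction ρ U) (trivialMeasure G d L) β with hw
  have hmgf : 0 < mgf (fun U => -wilsonAction ρ U) (trivialMeasure G d L) β :=
    mgf_pos (integrable_trivialMeasure_of_continuous_group
      (continuous_exp.comp (continuous_const.mul (continuous_wilsonAction_of_continuous ρ hρ).neg)))
  have hw0 : ∀ U, 0 < w U := fun U => div_pos (exp_pos _) hmgf
  have hwc : Continuous w :=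
    (continuous_exp.comp (continuous_const.mul (continuous_wilsonAction_of_continuous ρ hρ).neg)).div_const _
  have hwi : Integrable w (trivialMeasure G d L) := integrable_trivialMeasure_of_continuous_group hwc
  have hqi : Integrable q (trivialMeasure G d L) := by
    by_contra h
    rw [integral_undef h] at hq1
    exact zero_ne_one hq1
  have hZ : ∫ U, w U ∂(trivialMeasure G d L) = 1 := integral_wilsonDensity_eq_one (d := d) (L := L) ρ hρ β
  have hg0' : ∫ U, g U * w U ∂(trivialMeasure G d L) = 0 := by
    rw [integral_mul_wilsonDensity_eq ρ hρ β, hg0]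
  have h := tauInt_autocorr_le hw0 hwc.measurable hwi hq0 hqm hqi hq1 hC hgm hgb hg0'
  have e : (fun n => (∫ U, g U * ((imhOp (trivialMeasure G d L) w q)^[n] g) U * w U ∂(trivialMeasure G d L)) /
      ∫ U, g U ^ 2 * w U ∂(trivialMeasure G d L)) =
      fun n => (∫ U, g U * ((imhOp (trivialMeasure G d L) w q)^[n] g) U ∂(wilsonMeasure (d := d) (L := L) ρ β)) /
        ∫ U, g U ^ 2 ∂(wilsonMeasure (d := d) (L := L) ρ β) := by
    funext n
    rw [integral_mul_wilsonDensity_eq ρ hρ β, integral_mul_wilsonDensity_eq ρ hρ β]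
  rw [e, hZ, div_one] at h
  exact h

end Wilson

end Summit.Ventures.LatticeQCDFlow.TrivializingMaps

end
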